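import Summits.ResolutionOfSingularities.ResolutionOfSingularities.Theorems.PAlterationPicoverTowerTransport
import Summits.ResolutionOfSingularities.ResolutionOfSingularities.Theorems.PAlterationPicoverLocalModelOfDegP

/-!
# Transport of resolutions from an affine model of a `p`-th-root cover
# (crux `Picover`, line `degree-p-tower`, gen 2 — part 1 of 2)

Route `ResolutionOfSingularities/pAlteration`, crux `Picover` (stmt-ResolutionOfSingularities-0554),
whose degree-`p` residue reads: `W` regular integral separated of finite type over a field `k` of
characteristic `p`, `L ⊇ K(W)` purely inseparable of degree `p` ⟹ `HasResolution (normalizationIn W L)`.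
This file supplies the three ingredients of the implication "local model (stmt-0557) ⟹ residue for
AFFINE `W`" proved in part 2 (`PAlterationPicoverAffineOfLocalModel.lean`):

* field theory (`adjoin_eq_top_and_pow_mem`, `exists_generator_pow_eq`): in a purely inseparable
  extension `L/K` of prime degree `p = char K`, every `x ∈ L ∖ K` generates and has `x^p ∈ K`;
  if `K = Frac R`, clearing denominators gives a generator `z` with `z^p = c ∈ R`;
* algebra (`exists_lift_of_pow_eq`, `injective_lift`): the reduced model
  `Q = (R[T]/(T^p − c))_red` maps to `L` by `T ↦ z`, injectively (its kernel is a prime of the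
  integral extension `Q/R` over `0`);
* geometry (`hasResolution_normalizationIn_of_affineModel`): for `W` affine integral locally of
  finite type over `k`, `L/K(W)` finite, `Q` a domain finite over `Γ(W, ⊤)` with an injective
  `ψ : Q → L` over `Γ(W, ⊤)` whose image contains a generator of `L/K(W)`: a resolution
  `π : X' → Spec Q` gives one of `normalizationIn W L` — the composite `X' → Spec Q → W` is proper
  dominant with generic fibre the generic point and `K(X') ≅ Frac Q ≅ L` over `K(W)`, so the
  regular `X'` resolves `X'^L` (`BaseCase.stub_baseCase`) and the landed transport theorem
  `TowerTransport.hasResolution_normalizationIn_of_isProper` applies.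

Sources: Q. Liu, *Algebraic Geometry and Arithmetic Curves* (2002), §4.1.2 (normalization in an
extension); M. Temkin, *Inseparable local uniformization*, J. Algebra 373 (2013), Rem. 1.3.5 (ii).
The algebra is folklore. No new definitions.
-/

noncomputable section

set_option linter.dupNamespace false -- mandated namespace of this single-conjunct summit

open CategoryTheory AlgebraicGeometry TopologicalSpace Polynomial
open Literature.AlgebraicGeometry.Resolution Literature.AlgebraicGeometry.Motives
open Summit.ResolutionOfSingularities.ResolutionOfSingularities.Theorems.Picover

namespace Summit.ResolutionOfSingularities.ResolutionOfSingularities.Theorems.Picover.AffineModel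

/-! ## Field theory: generators of a purely inseparable extension of prime degree -/

/-- **In a purely inseparable extension `L/K` of prime degree `p = char K`, every `x ∈ L ∖ K`
generates `L` over `K` and satisfies `x ^ p ∈ K`**: `[K(x) : K]` divides `p` and is not `1`, so
`K(x) = L`; the minimal polynomial of `x` is `X^{p^n} - y` (Mathlib
`IsPurelyInseparable.minpoly_eq_X_pow_sub_C`) of degree `p`, so `n = 1` and `x^p = y`.
[folklore] -/
theorem adjoin_eq_top_and_pow_mem {K L : Type*} [Field K] [Field L] [Algebra K L] {p : ℕ}
    (hp : p.Prime) [CharP K p] [IsPurelyInseparable K L] (hdeg : Module.finrank K L = p) {x : L}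
    (hx : x ∉ Set.range (algebraMap K L)) :
    IntermediateField.adjoin K {x} = ⊤ ∧ ∃ y : K, x ^ p = algebraMap K L y := by
  haveI : ExpChar K p := ExpChar.prime hp
  haveI : FiniteDimensional K L := Module.finite_of_finrank_pos (by rw [hdeg]; exact hp.pos)
  have hint : IsIntegral K x := .of_finite K x
  -- `[K(x) : K]` divides `p` and is not `1`, hence equals `p`, hence `K(x) = L`
  have hdvd : Module.finrank K (IntermediateField.adjoin K {x}) ∣ p := by
    rw [← hdeg, ← IntermediateField.finrank_top' (F := K) (E := L)]
    exact IntermediateField.finrank_dvd_of_le_right le_top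
  have hne : Module.finrank K (IntermediateField.adjoin K {x}) ≠ 1 := by
    rw [Ne, IntermediateField.finrank_adjoin_simple_eq_one_iff, IntermediateField.mem_bot]
    exact hx
  have hrank : Module.finrank K (IntermediateField.adjoin K {x}) = p :=
    ((Nat.dvd_prime hp).mp hdvd).resolve_left hne
  have htop : IntermediateField.adjoin K {x} = ⊤ :=
    IntermediateField.eq_of_le_of_finrank_eq le_top
      (by rw [hrank, IntermediateField.finrank_top', hdeg])
  refine ⟨htop, ?_⟩
  -- the minimal polynomial is `X ^ p ^ n - C y` of degree `p`, so `n = 1`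
  obtain ⟨n, y, hmin⟩ := IsPurelyInseparable.minpoly_eq_X_pow_sub_C K p x
  have hnat : (minpoly K x).natDegree = p := by
    rw [← IntermediateField.adjoin.finrank hint, hrank]
  rw [hmin, natDegree_X_pow_sub_C] at hnat
  have hn : n = 1 := by
    have h1 : p ^ n = p ^ 1 := by rw [pow_one]; exact hnat
    exact Nat.pow_right_injective hp.two_le h1
  subst hn
  refine ⟨y, ?_⟩
  have h0 := minpoly.aeval K x
  rw [hmin, pow_one, map_sub, map_pow, aeval_X, aeval_C, sub_eq_zero] at h0
  exact h0

/-- **Clearing denominators.** If `K = Frac R` and `L/K` is purely inseparable of prime degree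
`p = char K`, there is `z ∈ L` with `L = K(z)` and `z ^ p = c` for some `c ∈ R`: pick
`x ∈ L ∖ K` (it exists as `[L : K] = p > 1`), write `x ^ p = a / b` and take `z = b x`,
`c = a b^{p-1}`. [folklore] -/
theorem exists_generator_pow_eq {R K L : Type*} [CommRing R] [IsDomain R] [Field K] [Field L]
    [Algebra R K] [IsFractionRing R K] [Algebra K L] {p : ℕ} (hp : p.Prime) [CharP K p]
    [IsPurelyInseparable K L] (hdeg : Module.finrank K L = p) :
    ∃ (z : L) (c : R), IntermediateField.adjoin K {z} = ⊤ ∧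
      z ^ p = algebraMap K L (algebraMap R K c) := by
  haveI : FiniteDimensional K L := Module.finite_of_finrank_pos (by rw [hdeg]; exact hp.pos)
  -- some `x ∉ K`
  obtain ⟨x, hx⟩ : ∃ x : L, x ∉ Set.range (algebraMap K L) := by
    by_contra h
    simp only [not_exists, not_not] at h
    have hbot : (⊥ : IntermediateField K L) = ⊤ := by
      rw [eq_top_iff]
      intro y _
      exact IntermediateField.mem_bot.mpr (h y)
    have h1 : Module.finrank K L = 1 := by
      rw [← IntermediateField.finrank_top', ← hbot, IntermediateField.finrank_bot]
    rw [hdeg] at h1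
    exact hp.one_lt.ne' h1
  obtain ⟨-, y, hy⟩ := adjoin_eq_top_and_pow_mem hp hdeg hx
  -- `y = a / b`
  obtain ⟨a, b, hb, rfl⟩ := IsFractionRing.div_surjective (A := R) y
  have hb0 : algebraMap R K b ≠ 0 :=
    IsFractionRing.to_map_ne_zero_of_mem_nonZeroDivisors hb
  set β : L := algebraMap K L (algebraMap R K b) with hβ
  have hβ0 : β ≠ 0 := by rw [hβ]; exact (_root_.map_ne_zero _).mpr hb0
  refine ⟨x * β, a * b ^ (p - 1), ?_, ?_⟩
  · -- `x β ∉ K` as well, so it generates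
    have hx' : x * β ∉ Set.range (algebraMap K L) := by
      rintro ⟨t, ht⟩
      apply hx
      refine ⟨t * (algebraMap R K b)⁻¹, ?_⟩
      rw [map_mul, map_inv₀, ht, ← hβ, mul_assoc, mul_inv_cancel₀ hβ0, mul_one]
    exact (adjoin_eq_top_and_pow_mem hp hdeg hx').1
  · have hp1 : p = p - 1 + 1 := (Nat.sub_add_cancel hp.one_le).symm
    rw [mul_pow, hy, hβ, ← map_pow, ← map_mul]
    congr 1
    rw [map_mul, map_pow]
    conv_lhs => rw [hp1, pow_succ]
    rw [← mul_assoc, div_mul_eq_mul_div, div_mul_cancel₀ _ hb0]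

/-- A subfield of `L` containing the image of `K` and an element `z` with `K(z) = L` is all of
`L`. [folklore] -/
theorem subfield_eq_top_of_mem {K L : Type*} [Field K] [Field L] [Algebra K L] (S : Subfield L)
    (hK : ∀ y : K, algebraMap K L y ∈ S) {z : L} (hz : z ∈ S)
    (htop : IntermediateField.adjoin K {z} = ⊤) : S = ⊤ := by
  have hle : IntermediateField.adjoin K {z} ≤ S.toIntermediateField hK :=
    IntermediateField.adjoin_le_iff.mpr (Set.singleton_subset_iff.mpr hz)
  rw [htop, top_le_iff] at hle
  rw [eq_top_iff]
  intro y _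
  have hy : y ∈ S.toIntermediateField hK := by rw [hle]; trivial
  exact hy

/-! ## Algebra: the reduced model `Q = (R[T]/(T^p - c))_red` maps injectively to `L` -/

section Model

variable {p : ℕ} {R : Type} [CommRing R] [IsDomain R] (c : R)

omit [IsDomain R] in
/-- **The map `Q = (R[T]/(T^p - c))_red → L`, `T ↦ z`** for a ring map `i : R → L` to a field
and `z ^ p = i c`: it sends the class of `T` to `z` and restricts to `i` on `R`. [folklore] -/
theorem exists_lift_of_pow_eq {L : Type*} [Field L] (i : R →+* L) {z : L} (hz : z ^ p = i c) :
    ∃ ψ : (AdjoinRoot ((X : R[X]) ^ p - C c) ⧸ nilradical (AdjoinRoot ((X : R[X]) ^ p - C c)))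
      →+* L, ψ.comp (algebraMap R _) = i ∧ ψ (Ideal.Quotient.mk _ (AdjoinRoot.root _)) = z := by
  have hroot : ((X : R[X]) ^ p - C c).eval₂ i z = 0 := by
    rw [eval₂_sub, eval₂_X_pow, eval₂_C, hz, sub_self]
  let ψ₀ : AdjoinRoot ((X : R[X]) ^ p - C c) →+* L := AdjoinRoot.lift i z hroot
  have hker : ∀ s ∈ nilradical (AdjoinRoot ((X : R[X]) ^ p - C c)), ψ₀ s = 0 :=
    fun s hs => ((mem_nilradical.mp hs).map ψ₀).eq_zero
  refine ⟨Ideal.Quotient.lift _ ψ₀ hker, ?_, ?_⟩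
  · ext r
    rw [RingHom.comp_apply, IsScalarTower.algebraMap_apply R (AdjoinRoot ((X : R[X]) ^ p - C c))
      (AdjoinRoot ((X : R[X]) ^ p - C c) ⧸ nilradical (AdjoinRoot ((X : R[X]) ^ p - C c))),
      Ideal.Quotient.algebraMap_eq, Ideal.Quotient.lift_mk, AdjoinRoot.algebraMap_eq]
    exact AdjoinRoot.lift_of hroot
  · rw [Ideal.Quotient.lift_mk]
    exact AdjoinRoot.lift_root hroot

/-- **`Q → L` is injective** when `R → L` is injective and `p = char R` is prime: `Q` is a domain
(`isPrime_nilradical_adjoinRoot`), integral over `R`, and the kernel is a prime lying over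
`(0)`, hence `(0)` (Mathlib `Ideal.eq_bot_of_comap_eq_bot`). [folklore] -/
theorem injective_lift (hp : p.Prime) [CharP R p] {L : Type*} [Field L] (i : R →+* L)
    (hi : Function.Injective i)
    (ψ : (AdjoinRoot ((X : R[X]) ^ p - C c) ⧸ nilradical (AdjoinRoot ((X : R[X]) ^ p - C c)))
      →+* L) (hψ : ψ.comp (algebraMap R _) = i) :
    Function.Injective ψ := by
  haveI := LocalModelOfDegP.isPrime_nilradical_adjoinRoot c hp
  haveI : IsDomain
      (AdjoinRoot ((X : R[X]) ^ p - C c) ⧸ nilradical (AdjoinRoot ((X : R[X]) ^ p - C c))) :=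
    Ideal.Quotient.isDomain _
  haveI : Module.Finite R (AdjoinRoot ((X : R[X]) ^ p - C c)) :=
    (AdjoinRoot.powerBasis' (monic_X_pow_sub_C c hp.ne_zero)).finite
  haveI : Module.Finite R
      (AdjoinRoot ((X : R[X]) ^ p - C c) ⧸ nilradical (AdjoinRoot ((X : R[X]) ^ p - C c))) :=
    Module.Finite.trans (AdjoinRoot ((X : R[X]) ^ p - C c)) _
  haveI : Algebra.IsIntegral R
      (AdjoinRoot ((X : R[X]) ^ p - C c) ⧸ nilradical (AdjoinRoot ((X : R[X]) ^ p - C c))) :=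
    Algebra.IsIntegral.of_finite R _
  rw [RingHom.injective_iff_ker_eq_bot]
  apply Ideal.eq_bot_of_comap_eq_bot (R := R)
  rw [RingHom.comap_ker, hψ]
  exact (RingHom.injective_iff_ker_eq_bot i).mp hi

end Model

/-! ## Geometry: transport from a resolved affine model -/

/-- **Transport from a resolved affine model.** Let `W` be an affine integral scheme locally of
finite type over a field `k`, `L ⊇ K(W)` a finite extension, and `Q` a domain with a finite
injective ring map `g : Γ(W, ⊤) → Q` and an injective ring map `ψ : Q → L` restricting to
`Γ(W, ⊤) → K(W) → L` on `Γ(W, ⊤)`, whose image contains a generator `z` of `L/K(W)`. If `Spec Q`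
has a resolution then so has `normalizationIn W L`: for a resolution `π : X' → Spec Q`, the
composite `ρ : X' → Spec Q → Spec Γ(W, ⊤) ≅ W` is proper dominant with generic fibre the generic
point, `K(X') ≅ Frac Q ≅ L` over `K(W)` (so `[L : K(X')] = 1` and the regular `X'` resolves
`X'^L`, `BaseCase.stub_baseCase`), and `TowerTransport.hasResolution_normalizationIn_of_isProper`
applies. [folklore] -/
theorem hasResolution_normalizationIn_of_affineModel : ∀ (k : Type) [Field k] (W : Scheme.{0}) [IsIntegral W] [IsAffine W] [Nonempty (⊤ : W.Opens)] (f : W ⟶ Spec (.of k)) [LocallyOfFiniteType f] (L : Type) [Field L] [Algebra W.functionField L] [FiniteDimensional W.functionField L] (Q : CommRingCat.{0}) [IsDomain Q] (g : Γ(W, ⊤) ⟶ Q) [IsFinite (Spec.map g)] (ψ : Q →+* L) (t : Q), Function.Injective g.hom → Function.Injective ψ → ψ.comp g.hom = (algebraMap W.functionField L).comp (algebraMap Γ(W, ⊤) W.functionField) → IntermediateField.adjoin W.functionField {ψ t} = ⊤ → Scheme.HasResolution (Spec Q) → Scheme.HasResolution (normalizationIn W L) := by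
  intro k _ W _ _ _ f _ L _ _ _ Q _ g _ ψ t hg hψinj hψR hztop hQ
  have hU : IsAffineOpen (⊤ : W.Opens) := isAffineOpen_top W
  haveI : IsFractionRing Γ(W, ⊤) W.functionField :=
    functionField_isFractionRing_of_isAffineOpen W ⊤ hU
  -- the resolution of `Spec Q`
  obtain ⟨X', π, hπ⟩ := hQ
  haveI : IsProper π := hπ.isProper
  haveI : IsReduced X' := hπ.isRegular.isReduced
  haveI : IsIntegral X' := hπ.isBirational.isIntegral
  haveI : IsDominant π := hπ.isBirational.isDominant
  -- `Spec g : Spec Q → Spec R` and the chart `ι : Spec R → W`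
  haveI : IsDominant (Spec.map g) := RatFn.isDominant_SpecMap_of_injective g hg
  haveI : IsDominant hU.fromSpec := RatFn.isDominant_fromSpec hU
  haveI : IsIso hU.fromSpec := by
    rw [IsAffineOpen.fromSpec_top]
    infer_instance
  -- the proper dominant `ρ : X' → W`
  obtain ⟨ρ, hρ⟩ : ∃ ρ : X' ⟶ W, ρ = π ≫ Spec.map g ≫ hU.fromSpec := ⟨_, rfl⟩
  haveI : IsProper ρ := by rw [hρ]; infer_instance
  haveI : IsDominant ρ := by rw [hρ]; infer_instance
  -- function fields: `K(Spec Q) = Frac Q → L` extends `ψ`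
  let ψK : (Spec Q).functionField →+* L := IsFractionRing.lift hψinj
  have hψK : ∀ q : Q, ψK (algebraMap Q (Spec Q).functionField q) = ψ q := fun q =>
    IsFractionRing.lift_algebraMap hψinj q
  -- `K(Spec Q) ≅ K(X')` along the birational `π`
  have hbij : Function.Bijective (RatFn.functionFieldMap π) :=
    TowerTransport.bijective_functionFieldMap_of_isIso π
      hπ.isBirational.isIso_stalkMap_genericPoint
  let eπ : (Spec Q).functionField ≃+* X'.functionField := RingEquiv.ofBijective _ hbij
  letI : Algebra X'.functionField L := (ψK.comp eπ.symm.toRingHom).toAlgebra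
  have halg : algebraMap X'.functionField L = ψK.comp eπ.symm.toRingHom := rfl
  -- `(Spec g ≫ ι)^♯ (r) = g r ∈ K(Spec Q)` for `r ∈ R`
  have hgι : ∀ r : Γ(W, ⊤), RatFn.functionFieldMap (Spec.map g ≫ hU.fromSpec)
      (algebraMap Γ(W, ⊤) W.functionField r) =
        algebraMap Q (Spec Q).functionField (g.hom r) := by
    intro r
    rw [RatFn.functionFieldMap_comp, RingHom.comp_apply, RatFn.functionFieldMap_fromSpec hU r]
    exact RatFn.functionFieldMap_SpecMap g r
  -- `ψK ∘ (Spec g ≫ ι)^♯ = (K(W) → L)`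
  have key : ψK.comp (RatFn.functionFieldMap (Spec.map g ≫ hU.fromSpec)) =
      algebraMap W.functionField L := by
    refine IsLocalization.ringHom_ext (nonZeroDivisors Γ(W, ⊤)) ?_
    ext r
    rw [RingHom.comp_apply, RingHom.comp_apply, hgι r, hψK, ← RingHom.comp_apply, hψR]
  have hcompat : (algebraMap X'.functionField L).comp (RatFn.functionFieldMap ρ) =
      algebraMap W.functionField L := by
    rw [halg, RatFn.functionFieldMap_congr hρ, RatFn.functionFieldMap_comp, ← key]
    ext y
    change ψK (eπ.symm (eπ (RatFn.functionFieldMap (Spec.map g ≫ hU.fromSpec) y))) = _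
    rw [eπ.symm_apply_apply]
    rfl
  -- `[L : K(X')] = 1`: the structure map is bijective
  have hsurjψK : Function.Surjective ψK := by
    have hS : ψK.fieldRange = ⊤ := by
      refine subfield_eq_top_of_mem (K := W.functionField) ψK.fieldRange ?_ ?_ hztop
      · intro y
        exact ⟨RatFn.functionFieldMap (Spec.map g ≫ hU.fromSpec) y, RingHom.congr_fun key y⟩
      · exact ⟨algebraMap Q (Spec Q).functionField t, hψK t⟩
    intro l
    have hl : l ∈ ψK.fieldRange := by rw [hS]; trivial
    exact RingHom.mem_fieldRange.mp hl
  have hbijAlg : Function.Bijective (algebraMap X'.functionField L) := by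
    rw [halg]
    exact ⟨ψK.injective.comp eπ.symm.injective, hsurjψK.comp eπ.symm.surjective⟩
  have hdeg1 : Module.finrank X'.functionField L = 1 :=
    Algebra.finrank_eq_one_iff_bijective_algebraMap.mpr hbijAlg
  haveI : FiniteDimensional X'.functionField L :=
    Module.finite_of_finrank_pos (by rw [hdeg1]; exact one_pos)
  -- the regular `X'` resolves `X'^L`
  have hres : Scheme.HasResolution (normalizationIn X' L) :=
    BaseCase.stub_baseCase X' L
      (FunctionFieldNormalizationIn.stub_functionField_normalizationIn X' L) hπ.isRegular hdeg1
  -- the fibre of `ρ` over the generic point of `W` is the generic point of `X'`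
  have hfib : ∀ w' : X', ρ w' = genericPoint W → w' = genericPoint X' := by
    intro w' hw'
    rw [hρ, Scheme.Hom.comp_apply] at hw'
    have h1 : π w' = genericPoint (Spec Q) :=
      TowerTransport.eq_genericPoint_of_isIntegralHom (Spec.map g ≫ hU.fromSpec) hw'
    obtain ⟨U, hUd, -, hUiso⟩ := hπ.isBirational
    haveI := hUiso
    have hηU : genericPoint (Spec Q) ∈ U :=
      ((genericPoint_spec (Spec Q)).mem_open_set_iff U.isOpen).mpr (by simpa using hUd.nonempty)
    exact TowerTransport.subsingleton_preimage_of_isIso_morphismRestrict π U hηU h1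
      (RatFn.genericPoint_eq_of_isDominant π)
  exact TowerTransport.hasResolution_normalizationIn_of_isProper
    FunctionFieldNormalizationIn.stub_functionField_normalizationIn W f L X' ρ hcompat hfib hres

end Summit.ResolutionOfSingularities.ResolutionOfSingularities.Theorems.Picover.AffineModel

end
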